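import Summits.BirchSwinnertonDyer.Rank1Residual.GaloisImage.UnramifiedCupProductVanishing
import Summits.BirchSwinnertonDyer.Rank1Residual.GaloisImage.TransverseOrthogonal
import Literature.NumberTheory.GaloisRepresentations.LocalFieldCdTwo
import Literature.NumberTheory.GaloisRepresentations.LocalDualityTheorem
import HarnessLib

/-!
# Unramified classes cup to ZERO: the orthogonality half of Milne I Thm. 2.6 as a KERNEL theorem
# for EVERY family of local invariant maps
# (cell `b2b-bsdres`, team n1011, row T-UO-K; seat p04 GEN 6; file 2/3)

HONEST FRAMING (cell `b2b-bsdres`, run/shared/lean/b2b/bsd-rank1-residual/, verbatim in every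
file): the goal of the cell is to DELETE the COMBINATION-SHAPED residual classes of the
Birch–Swinnerton-Dyer formula for ALL analytic-rank `≤ 1` elliptic curves over `ℚ` — "full BSD
formula for every rank `≤ 1` curve in class `C`" assembled STRICTLY from published theorems — so
that the rank-`≤ 1` remainder becomes exactly the CONSTRUCTION-SHAPED classes, which are TYPED
(missing-input `Prop`s), NOT attempted. This is not "finishing BSD". Team n1011 (N10 / N11, the
additive block X4 ∧ `p = 3`): research route on the CONSTRUCTION-SHAPED class X4 (§I N11); no claim
beyond the stated classes; nothing is booked; no mark / label is changed by this file. Theorems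
only (no definition, no named fact, no `sorry`); TOOL theorems of local Galois cohomology.

## What and why

Milne, *ADT* I Thm. 2.6 ("`H¹(G/I, M)` and `H¹(G/I, M^d)` are the exact annihilators of each other in
the cup-product pairing") is typed in the tree as the PROPERTY `LocalInvariants.UnramifiedOrthogonal`
of a family of local invariant maps (`PoitouTateSelmerStructures.lean`), a conjunct of the named fact
`poitouTate_selmerStructure_duality` carried by every N11 consumer.  THIS FILE proves its
ORTHOGONALITY half for EVERY additive `inv_v`, with no class field theory: at a finite place `v` of
a number field `K` with `v ∤ n` (`N(v) = ℓ` prime, so that the inertia group of `K_v` fixes `μₙ(K̄)`,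
`TransverseCup.toLocal_mu_apply_of_mem_absInertia`) and a finite discrete `Γ_K`-module `M`
unramified at `v` (then so is `M^D = Hom(M, μₙ)`, `TransverseCup.toLocal_tateDual_apply_of_mem_absInertia`):

* **`UnramifiedCup.localTatePairing_eq_zero_of_mem_unramifiedSubgroup`: `a ∪ b = 0` in
  `H²(K_v, μₙ)` for `a ∈ H¹_ur(K_v, M)`, `b ∈ H¹_ur(K_v, M^D)`** — the representatives vanish on the
  inertia group `I = galUnr K_v` (`X11b.LocBridge.mem_unramifiedSubgroup_one_iff_forall_eq_zero`),
  and `H²(Γ_{K_v}/I, μₙ^I) = 0` (`subsingleton_two_quotient_galUnr_of_finite`, `cd(Ẑ) = 1`), so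
  `UnramifiedCup.cupClass_eq_zero_of_vanishing_of_subsingleton` applies;
* `localTatePairingZMod_eq_zero_of_mem_unramifiedSubgroup`: `⟨a, b⟩_v = inv_v(a ∪ b) = 0` for every
  additive `inv_v`;
* **`unramifiedSubgroup_tateDual_le_dualLocalCondition`: `H¹_ur(K_v, M^D) ≤ (H¹_ur(K_v, M))^*` for
  EVERY family `inv : LocalInvariants K n`** — the inclusion half of the first clause of
  `UnramifiedOrthogonal`, as a theorem about all families (in the predicate's own binders:
  `v ∤ n`, `GaloisRep.IsUnramifiedAt v ρ`; `N(v)` prime is used only to read the residue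
  characteristic).

The complement half ("exact annihilators") is Tate's local Euler–Poincaré characteristic count plus
the `H²`/`H⁰` duality; it is the subject of the sequel.  As in `TransverseLocalPairingVanishing.lean`
the classes are typed over `v.adicCompletion K` (definitionally the place `Sum.inr v`).

References: J. S. Milne, *Arithmetic Duality Theorems* (2006), I Thm. 2.6 [MilneADT2006];
J.-P. Serre, *Galois Cohomology* (1997), II §5.5 [SerreGaloisCohomology1997]; J.-P. Serre, *Local
Fields* (1979), IV §4 Cor. 2 to Prop. 16 [SerreLocalFields1979].
-/

noncomputable section

open CategoryTheory Function
open scoped ContRepresentation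

universe u

namespace Summit.BirchSwinnertonDyer.Rank1Residual.GaloisImage

namespace UnramifiedCup

open Field ValuativeRel NumberField IsDedekindDomain
open Literature.NumberTheory.GaloisRepresentations
open Literature.NumberTheory.GaloisRepresentations.IsNonarchimedeanLocalField
open _root_.TopRep _root_.ContRepresentation _root_.ContinuousCohomology
open Literature.NumberTheory.GaloisCohomology
open scoped NumberField

variable {K : Type u} [Field K] [NumberField K] {M : Type u} [AddCommGroup M] [TopologicalSpace M]
  [DiscreteTopology M] [Finite M] (ρ : DiscreteGaloisModule K M) (n : ℕ) [NeZero n]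
  (v : HeightOneSpectrum (𝓞 K))

/-- **Unramified classes cup to zero** (orthogonality half of Milne I Thm. 2.6, for the cup product
itself): for a finite discrete `Γ_K`-module `M`, `n ≠ 0`, a finite place `v` such that the inertia
group of `K_v` acts trivially on `M|_v` AND on `M^D|_v`, and `a ∈ H¹_ur(K_v, M)`, `b ∈ H¹_ur(K_v, M^D)`:
`a ∪ b = 0` in `H²(K_v, μₙ)`.  Representatives vanish on `I = galUnr K_v`
(`X11b.LocBridge.mem_unramifiedSubgroup_one_iff_forall_eq_zero`), `H²(Γ_{K_v}/I, μₙ^I) = 0`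
(`subsingleton_two_quotient_galUnr_of_finite`), and
`UnramifiedCup.cupClass_eq_zero_of_vanishing_of_subsingleton`. [cite: MilneADT2006, Ch. I, Thm. 2.6] -/
theorem localTatePairing_eq_zero_of_mem_unramifiedSubgroup
    (hI : ∀ t ∈ absInertia (v.adicCompletion K), ∀ m : M, GaloisRep.toLocal v ρ t m = m)
    (hID : ∀ t ∈ absInertia (v.adicCompletion K), ∀ f : DiscreteGaloisModule.TateDual K M n,
      GaloisRep.toLocal v (ρ.tateDual n) t f = f)
    {a : galoisCohomology (GaloisRep.toLocal v ρ) 1}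
    (ha : a ∈ DiscreteGaloisModule.unramifiedSubgroup (GaloisRep.toLocal v ρ) 1)
    {b : galoisCohomology (GaloisRep.toLocal v (ρ.tateDual n)) 1}
    (hb : b ∈ DiscreteGaloisModule.unramifiedSubgroup (GaloisRep.toLocal v (ρ.tateDual n)) 1) :
    DiscreteGaloisModule.localTatePairing ρ n (Sum.inr v) a b = 0 := by
  classical
  haveI := absoluteGaloisGroup_compactSpace (v.adicCompletion K)
  obtain ⟨f, rfl⟩ := oneCocycleClass_surjective _ a
  obtain ⟨g, rfl⟩ := oneCocycleClass_surjective _ b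
  have hf := (X11b.LocBridge.mem_unramifiedSubgroup_one_iff_forall_eq_zero (GaloisRep.toLocal v ρ) hI f).1 ha
  have hg := (X11b.LocBridge.mem_unramifiedSubgroup_one_iff_forall_eq_zero
    (GaloisRep.toLocal v (ρ.tateDual n)) hID g).1 hb
  -- `H²(Γ/I, μₙ^I) = 0` (`cd(Ẑ) = 1`)
  haveI : Finite (DiscreteGaloisModule.MuCarrier K n) := finite_muCarrier (F := K) n
  haveI : Subsingleton (continuousCohomology 2
      ((GaloisRep.toLocal v (DiscreteGaloisModule.mu K n)).quotientInvariants
        (galUnr (v.adicCompletion K))).toTopRep) :=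
    subsingleton_two_quotient_galUnr_of_finite (v.adicCompletion K) _ _
  change ContPairing.cupProduct (DiscreteGaloisModule.pairing (GaloisRep.toLocal v ρ)
      (GaloisRep.toLocal v (ρ.tateDual n)) (GaloisRep.toLocal v (DiscreteGaloisModule.mu K n))
      (DiscreteGaloisModule.tateDualEval K M n)
      (fun _ m f => DiscreteGaloisModule.tateDualEval_smul ρ n _ m f))
      (oneCocycleClass _ f) (oneCocycleClass _ g) = 0
  rw [ContPairing.cupProduct_oneCocycleClass]
  refine cupClass_eq_zero_of_vanishing_of_subsingleton (galUnr (v.adicCompletion K)) _ _ _ _ f g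
    (fun t ht => hf t ?_) (fun t ht => hg t ?_)
  · rw [← galUnr_eq_absInertia]; exact ht
  · rw [← galUnr_eq_absInertia]; exact ht

/-- **`⟨a, b⟩_v = inv_v(a ∪ b) = 0` for unramified `a`, `b`, for EVERY additive `inv_v`**
(no property of `inv_v` is used). [cite: MilneADT2006, Ch. I, Thm. 2.6] -/
theorem localTatePairingZMod_eq_zero_of_mem_unramifiedSubgroup
    (hI : ∀ t ∈ absInertia (v.adicCompletion K), ∀ m : M, GaloisRep.toLocal v ρ t m = m)
    (hID : ∀ t ∈ absInertia (v.adicCompletion K), ∀ f : DiscreteGaloisModule.TateDual K M n,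
      GaloisRep.toLocal v (ρ.tateDual n) t f = f)
    (inv : galoisCohomology ((DiscreteGaloisModule.mu K n).toLocal (Sum.inr v)) 2 →+ ZMod n)
    {a : galoisCohomology (GaloisRep.toLocal v ρ) 1}
    (ha : a ∈ DiscreteGaloisModule.unramifiedSubgroup (GaloisRep.toLocal v ρ) 1)
    {b : galoisCohomology (GaloisRep.toLocal v (ρ.tateDual n)) 1}
    (hb : b ∈ DiscreteGaloisModule.unramifiedSubgroup (GaloisRep.toLocal v (ρ.tateDual n)) 1) :
    DiscreteGaloisModule.localTatePairingZMod ρ n (Sum.inr v) inv a b = 0 := by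
  rw [DiscreteGaloisModule.localTatePairingZMod_apply,
    localTatePairing_eq_zero_of_mem_unramifiedSubgroup ρ n v hI hID ha hb, map_zero]

/-- **`H¹_ur(K_v, M^D) ≤ (H¹_ur(K_v, M))^*` for EVERY family `inv : LocalInvariants K n`** at a finite
place `v` of prime norm `ℓ` with `v ∤ n` where `M` is unramified — the inclusion half of the first
clause of `LocalInvariants.UnramifiedOrthogonal` (Milne I Thm. 2.6), in the predicate's own binders,
as a theorem about ALL families.  Inputs: `M` unramified at `v`
(`GaloisRep.isUnramifiedAt_iff_toLocal_holds`), `μₙ` and hence `M^D` unramified at `v ∤ n`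
(`TransverseCup.toLocal_tateDual_apply_of_mem_absInertia`). [cite: MilneADT2006, Ch. I, Thm. 2.6] -/
theorem unramifiedSubgroup_tateDual_le_dualLocalCondition (inv : LocalInvariants K n)
    {ℓ : ℕ} [Fact ℓ.Prime] (hℓ : Ideal.absNorm v.asIdeal = ℓ) (hv : ((n : ℕ) : 𝓞 K) ∉ v.asIdeal)
    (hur : GaloisRep.IsUnramifiedAt v ρ) :
    DiscreteGaloisModule.unramifiedSubgroup (GaloisRep.toLocal v (ρ.tateDual n)) 1 ≤
      inv.dualLocalCondition ρ (Sum.inr v)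
        (DiscreteGaloisModule.unramifiedSubgroup (GaloisRep.toLocal v ρ) 1) := by
  have hI : ∀ t ∈ absInertia (v.adicCompletion K), ∀ m : M, GaloisRep.toLocal v ρ t m = m := by
    intro t ht m
    have h := (GaloisRep.isUnramifiedAt_iff_toLocal_holds v ρ).1 hur t ht
    rw [h]
    rfl
  have hID : ∀ t ∈ absInertia (v.adicCompletion K), ∀ f : DiscreteGaloisModule.TateDual K M n,
      GaloisRep.toLocal v (ρ.tateDual n) t f = f :=
    fun t ht f => TransverseCup.toLocal_tateDual_apply_of_mem_absInertia ρ n v hℓ hv hur ht f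
  intro b hb a ha
  exact localTatePairingZMod_eq_zero_of_mem_unramifiedSubgroup ρ n v hI hID _ ha hb

end UnramifiedCup

end Summit.BirchSwinnertonDyer.Rank1Residual.GaloisImage

end
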